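import Summits.QuantumFields.YangMills.Theorems.UnitScaleTiltProp8FlatChart47Levels
import Literature.MathematicalPhysics.QuantumFieldTheory.Balaban1983to89.Setup
import HarnessLib

/-!
# Route `UnitScaleTilt`, crux K1 child «MinimiserStabilityRegPr» (stmt-QuantumFields-19200), registered stub V2′ `stub_halvingStep`
# (skeletons v8 5b4e846794b80374 ∕ v10 `BirthV10`) — **THE (152) SIZES OF THE CHART FIELD `A′ = A + H C(A)` FROM THE SIZES OF `A`, BOTH LETTERS**
# (owner MAP #3 ∕ ACK 4 (b) «(152)-size»: the `h1 h2 hr` inputs of ✓ p603846 `HalvingA1Row165TraceAnyW.row165_of_tracePairing_L5_anyW` read from ONE displayed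
# P1 output — the sup AND gradient sizes of the Thm-2 log field `A` — through the explicit preimage of F4's `FlatChart47Levels.chart47W_range`)

Cell `ym3-torus` (HUMAN RULING D-0037, YM ladder rung R3 — continuum SU(2) YM₃ on the torus is a RUNG, not the Clay problem), width seat
`ym-ust-19200-w5` gen 3.  `--supports stmt-QuantumFields-19200 --as helper`; def-free, 0 sorry, standard axioms.

THE PRINT ([Balaban1985Variational] p. 287 (59)–(62)): *«To solve the equation A′ − HD(A′) = A for a given A, we take A′ = A + HX … X = D(A + HX) (60) … there exists
exactly one solution of Eq. (59) satisfying L^jη|A′|, (L^jη)²|∇A′| < ε₂ + 16C₂B₀ε₂² < 2ε₂ (62)»*; p. 302: *«The configuration A′ satisfies (152) with 36 instead of 9»*.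
F4 part 7 (`chart47W_range`) types the SUP half with the explicit preimage `A′ = A + HC(A)` (its `D(A′)` is `C(A)`); the GRADIENT half — print's `(L^jη)²|∇A′|` — needs
the gradient row of `H` ((46)₂: *«|∇HB| ≦ B₀(Lʲη)⁻²|B|»*), displayed here as `hH'` (for the chart-`H` of record this row is WANTED №g26-1 (X3); for P2's `flatH` it is
✓ `HSupLetterG` row 2).

WHAT THIS FILE PROVES (finite `ι`, `β`; any `κ` with `src tgt : κ → ι`; weights `w₀` on `ι`, `w₁` on `κ`, `wB` on `β`; `V` a complex normed space):
* §1 **`size_preimage_le`** — if `H` has the sup row `(∀ c, wB c‖X c‖ ≤ t) ⇒ w₀ i‖HX i‖ ≤ B_H t` and the gradient row `… ⇒ w₁ p‖HX(tgt p) − HX(src p)‖ ≤ B_H′ t`, `C` has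
  (44)∕(hCq) below `R`, and `A` has sizes `w₀‖A‖ ≤ δ < R`, `w₁‖A(tgt) − A(src)‖ ≤ δ′`, then `A′ := A + H(C A)` has `w₀‖A′‖ ≤ δ + B_H·C₂δ²` and
  `w₁‖A′(tgt) − A′(src)‖ ≤ δ′ + B_H′·C₂δ²` ((62), both letters).
* §2 **`size152_of_chartRange`** — the same packaged with F4's `chart47W_range` (so also `A′ − H(C A) = A`, `D(A′) = C(A)` is THE fixed point in the `4C₂ε²`-ball, and
  the open sup bound `< ε`): the (152) sizes of the chart field from the sizes of `A`.
* §3 **`size152_bond`** — the reading on a `Params` lattice with the F4∕cube-sequence gradient letter `w 2 b·c·‖Y⟨b₋+e_ν, dir b⟩ − Y b‖` and un-weighted index data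
  (`κ := PBond × Fin d`), i.e. LITERALLY the shapes `h1`∕`h2` of `row165_of_tracePairing_L5_anyW` (with `c = L^{K−n}`) for `A′ = A + H(C A)`.
HONEST SCOPE.  Triangle inequalities and bookkeeping; the sizes of `A` (P1: [B8] Thm 2 on the cube sequence, (1.31)∕(152)), the gradient row of the chart-`H` (X3) and the
smallness `r < a₃` are the consumer's.  NOT a claim about the stub, the crux, the rung or the mass gap.

References: T. Bałaban, CMP **102** (1985) 277–309 [Balaban1985Variational] (44)–(46) p.285, (59)–(62) p.287, (152) p.301, (157) p.302.
-/

set_option autoImplicit false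

noncomputable section

namespace Summit.QuantumFields.YangMills.Theorems.HalvingSize152OfChart

open Literature.MathematicalPhysics.QuantumFieldTheory.Balaban1983to89
open FlatChart47Levels (chart47W_range)

/-! ## §1 Both letters of the explicit preimage `A′ = A + H(C A)` -/

section Generic

variable {ι κ β : Type*} {V : Type*} [NormedAddCommGroup V] [NormedSpace ℂ V]
variable (src tgt : κ → ι) (w₀ : ι → ℝ) (w₁ : κ → ℝ) (wB : β → ℝ)

/-- **(62), BOTH LETTERS, FOR THE EXPLICIT PREIMAGE**: `w₀‖A + H(C A)‖ ≤ δ + B_H·C₂δ²` and `w₁‖(A + H(C A))(tgt) − (A + H(C A))(src)‖ ≤ δ′ + B_H′·C₂δ²` from the two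
rows of `H`, the quadratic letter of `C` below `R`, and the two sizes `δ < R`, `δ′` of `A`. [cite: Balaban1985Variational, (59)-(62) p.287, (46) p.285] -/
theorem size_preimage_le (H : (β → V) →ₗ[ℂ] (ι → V)) (C : (ι → V) → (β → V)) {B_H B_H' C₂ R δ δ' : ℝ}
    (hH : ∀ (X : β → V) (t : ℝ), (∀ c, wB c * ‖X c‖ ≤ t) → ∀ i, w₀ i * ‖H X i‖ ≤ B_H * t)
    (hH' : ∀ (X : β → V) (t : ℝ), (∀ c, wB c * ‖X c‖ ≤ t) → ∀ p, w₁ p * ‖H X (tgt p) - H X (src p)‖ ≤ B_H' * t)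
    (hCq : ∀ (Y : ι → V) (r : ℝ), r < R → (∀ i, w₀ i * ‖Y i‖ ≤ r) → ∀ c, wB c * ‖C Y c‖ ≤ C₂ * r ^ 2)
    (hw₀ : ∀ i, 0 ≤ w₀ i) (hw₁ : ∀ p, 0 ≤ w₁ p)
    (A : ι → V) (hδR : δ < R) (hA₀ : ∀ i, w₀ i * ‖A i‖ ≤ δ) (hA₁ : ∀ p, w₁ p * ‖A (tgt p) - A (src p)‖ ≤ δ') :
    (∀ i, w₀ i * ‖(A + H (C A)) i‖ ≤ δ + B_H * (C₂ * δ ^ 2)) ∧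
      ∀ p, w₁ p * ‖(A + H (C A)) (tgt p) - (A + H (C A)) (src p)‖ ≤ δ' + B_H' * (C₂ * δ ^ 2) := by
  have hCA : ∀ c, wB c * ‖C A c‖ ≤ C₂ * δ ^ 2 := hCq A δ hδR hA₀
  refine ⟨fun i => ?_, fun p => ?_⟩
  · calc w₀ i * ‖(A + H (C A)) i‖ = w₀ i * ‖A i + H (C A) i‖ := rfl
      _ ≤ w₀ i * (‖A i‖ + ‖H (C A) i‖) := mul_le_mul_of_nonneg_left (norm_add_le _ _) (hw₀ i)
      _ = w₀ i * ‖A i‖ + w₀ i * ‖H (C A) i‖ := mul_add _ _ _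
      _ ≤ δ + B_H * (C₂ * δ ^ 2) := add_le_add (hA₀ i) (hH (C A) _ hCA i)
  · have e : (A + H (C A)) (tgt p) - (A + H (C A)) (src p) = (A (tgt p) - A (src p)) + (H (C A) (tgt p) - H (C A) (src p)) := by
      simp only [Pi.add_apply]; abel
    rw [e]
    calc w₁ p * ‖(A (tgt p) - A (src p)) + (H (C A) (tgt p) - H (C A) (src p))‖
        ≤ w₁ p * (‖A (tgt p) - A (src p)‖ + ‖H (C A) (tgt p) - H (C A) (src p)‖) := mul_le_mul_of_nonneg_left (norm_add_le _ _) (hw₁ p)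
      _ = w₁ p * ‖A (tgt p) - A (src p)‖ + w₁ p * ‖H (C A) (tgt p) - H (C A) (src p)‖ := mul_add _ _ _
      _ ≤ δ' + B_H' * (C₂ * δ ^ 2) := add_le_add (hA₁ p) (hH' (C A) _ hCA p)

end Generic

/-! ## §2 Packaged with F4's `chart47W_range` -/

section Packaged

variable {ι κ β : Type*} [Fintype ι] [Fintype β] {V : Type*} [NormedAddCommGroup V] [NormedSpace ℂ V] [FiniteDimensional ℂ V]
variable (src tgt : κ → ι) (w₀ : ι → ℝ) (w₁ : κ → ℝ) (wB : β → ℝ)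

/-- **THE (152) SIZES OF THE CHART FIELD FROM THE SIZES OF `A`** (print (59)–(62) + p. 302): under the data of F4's `chart47W_range` (Prop. 3's `C`, `H` with the sup row,
`9C₂B₀ε < 1`, `3ε ≤ R`, `0 < δ ≤ ε`, `δ + B₀C₂δ² ≤ ε`) plus the GRADIENT row of `H` (`B_H′`) and the gradient size `δ′` of `A`: the explicit preimage `A′ := A + H(C A)` of an `A` with
`w₀‖A‖ < δ` satisfies `A′ − H(C A) = A`, its chart remainder is `D(A′) = C(A)` (THE fixed point in the `4C₂ε²`-ball), `w₀‖A′‖ < ε`, and BOTH (152) letters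
`w₀‖A′‖ ≤ δ + B₀C₂δ²`, `w₁‖A′(tgt) − A′(src)‖ ≤ δ′ + B_H′C₂δ²`. [cite: Balaban1985Variational, (59)-(62) p.287, Prop. 3 p.289, (152) p.301, (157) p.302] -/
theorem size152_of_chartRange (hw₀ : ∀ i, 0 < w₀ i) (hwB : ∀ c, 0 < wB c) (hw₁ : ∀ p, 0 ≤ w₁ p)
    (C : (ι → V) → (β → V)) (H : (β → V) →ₗ[ℂ] (ι → V)) {C₂ R B₀ B_H' ε δ δ' : ℝ} (hC₂ : 0 ≤ C₂) (hB₀ : 0 ≤ B₀)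
    (hH : ∀ (X : β → V) (t : ℝ), (∀ c, wB c * ‖X c‖ ≤ t) → ∀ i, w₀ i * ‖H X i‖ ≤ B₀ * t)
    (hH' : ∀ (X : β → V) (t : ℝ), (∀ c, wB c * ‖X c‖ ≤ t) → ∀ p, w₁ p * ‖H X (tgt p) - H X (src p)‖ ≤ B_H' * t)
    (hCq : ∀ (Y : ι → V) (r : ℝ), r < R → (∀ i, w₀ i * ‖Y i‖ ≤ r) → ∀ c, wB c * ‖C Y c‖ ≤ C₂ * r ^ 2)
    (hCd : DifferentiableOn ℂ C {Y : ι → V | ∀ i, w₀ i * ‖Y i‖ < R})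
    (hq : 9 * C₂ * B₀ * ε < 1) (hR : 3 * ε ≤ R) (hδ0 : 0 < δ) (hδε : δ ≤ ε) (hδ : δ + B₀ * (C₂ * δ ^ 2) ≤ ε)
    (A : ι → V) (hA : ∀ i, w₀ i * ‖A i‖ < δ) (hA₁ : ∀ p, w₁ p * ‖A (tgt p) - A (src p)‖ ≤ δ') :
    (A + H (C A)) - H (C A) = A ∧ C ((A + H (C A)) - H (C A)) = C A ∧
      (∀ D' : β → V, (∀ c, wB c * ‖D' c‖ ≤ 4 * C₂ * ε ^ 2) → C ((A + H (C A)) - H D') = D' → D' = C A) ∧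
      (∀ i, w₀ i * ‖(A + H (C A)) i‖ < ε) ∧
      (∀ i, w₀ i * ‖(A + H (C A)) i‖ ≤ δ + B₀ * (C₂ * δ ^ 2)) ∧
      ∀ p, w₁ p * ‖(A + H (C A)) (tgt p) - (A + H (C A)) (src p)‖ ≤ δ' + B_H' * (C₂ * δ ^ 2) := by
  obtain ⟨hlt, -, hfix, huniq, hcancel⟩ := chart47W_range hw₀ hwB C H hC₂ hB₀ hH hCq hCd hq hR hδ0 hδε hδ A hA
  have hδR : δ < R := by linarith
  obtain ⟨h0, h1⟩ := size_preimage_le src tgt w₀ w₁ wB H C hH hH' hCq (fun i => (hw₀ i).le) hw₁ A hδR (fun i => (hA i).le) hA₁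
  exact ⟨hcancel, hfix, huniq, hlt, h0, h1⟩

end Packaged

/-! ## §3 The reading on a lattice: the `h1`∕`h2` shapes of the (165)-A₁ row -/

section Lattice

variable {P : Params} {β : Type*} {V : Type*} [NormedAddCommGroup V] [NormedSpace ℂ V]

/-- **THE `h1`∕`h2` SHAPES OF `row165_of_tracePairing_L5_anyW` FOR `A′ = A + H(C A)`** (fine bonds of a `Params` lattice, weights `w 1`, `w 2`, gradient letter
`w 2 b·c·‖Y⟨b₋ + e_ν, dir b⟩ − Y b‖` with `c = L^{K−n}` at the cube sequence, un-weighted index data as in `ChartRemainderAt`): from the sup row `B_H` and the gradient row `B_H′`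
of `H`, the (hCq) letter of `C` below `R`, and the two sizes `δ < R`, `δ′` of `A`: `w 1 b·‖A′ b‖ ≤ δ + B_H C₂δ²` and `w 2 b·c·‖A′⟨b₋+e_ν, dir b⟩ − A′ b‖ ≤ δ′ + B_H′C₂δ²`.
[cite: Balaban1985Variational, (59)-(62) p.287, (152) p.301, (165) p.304] -/
theorem size152_bond (w : ℕ → PBond P 0 → ℝ) (c : ℝ) (hw1 : ∀ b, 0 ≤ w 1 b) (hw2 : ∀ b, 0 ≤ w 2 b) (hc : 0 ≤ c)
    (H : (β → V) →ₗ[ℂ] (PBond P 0 → V)) (C : (PBond P 0 → V) → (β → V)) {B_H B_H' C₂ R δ δ' : ℝ}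
    (hH : ∀ (X : β → V) (t : ℝ), (∀ i, ‖X i‖ ≤ t) → ∀ b, w 1 b * ‖H X b‖ ≤ B_H * t)
    (hH' : ∀ (X : β → V) (t : ℝ), (∀ i, ‖X i‖ ≤ t) → ∀ (b : PBond P 0) (ν : Fin P.d), w 2 b * c * ‖H X ⟨b.src.shift ν, b.dir⟩ - H X b‖ ≤ B_H' * t)
    (hCq : ∀ (Y : PBond P 0 → V) (r : ℝ), r < R → (∀ b, w 1 b * ‖Y b‖ ≤ r) → ∀ i, ‖C Y i‖ ≤ C₂ * r ^ 2)
    (A : PBond P 0 → V) (hδR : δ < R) (hA₀ : ∀ b, w 1 b * ‖A b‖ ≤ δ)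
    (hA₁ : ∀ (b : PBond P 0) (ν : Fin P.d), w 2 b * c * ‖A ⟨b.src.shift ν, b.dir⟩ - A b‖ ≤ δ') :
    (∀ b, w 1 b * ‖(A + H (C A)) b‖ ≤ δ + B_H * (C₂ * δ ^ 2)) ∧
      ∀ (b : PBond P 0) (ν : Fin P.d), w 2 b * c * ‖(A + H (C A)) ⟨b.src.shift ν, b.dir⟩ - (A + H (C A)) b‖ ≤ δ' + B_H' * (C₂ * δ ^ 2) := by
  -- `κ := PBond × Fin d`, `src p = p.1`, `tgt p = ⟨p.1₋ + e_ν, dir p.1⟩`, `w₁ p = w 2 p.1·c`, `wB = 1`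
  have h := size_preimage_le (fun p : PBond P 0 × Fin P.d => p.1) (fun p : PBond P 0 × Fin P.d => (⟨p.1.src.shift p.2, p.1.dir⟩ : PBond P 0))
    (w 1) (fun p : PBond P 0 × Fin P.d => w 2 p.1 * c) (fun _ : β => (1 : ℝ)) H C (B_H := B_H) (B_H' := B_H') (C₂ := C₂) (R := R) (δ := δ) (δ' := δ')
    (fun X t hX => hH X t fun i => by simpa only [one_mul] using hX i)
    (fun X t hX p => hH' X t (fun i => by simpa only [one_mul] using hX i) p.1 p.2)
    (fun Y r hr hY i => by rw [one_mul]; exact hCq Y r hr hY i)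
    hw1 (fun p => mul_nonneg (hw2 p.1) hc) A hδR hA₀ (fun p => hA₁ p.1 p.2)
  exact ⟨h.1, fun b ν => h.2 (b, ν)⟩

end Lattice

end Summit.QuantumFields.YangMills.Theorems.HalvingSize152OfChart

end
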